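import Summits.BirchSwinnertonDyer.BirchSwinnertonDyer.Theorems.ByReductionTypeAtTwoAdditiveOverK
import Summits.BirchSwinnertonDyer.Rank1Residual.X5.TwoAdicAdditiveL2CycC
import HarnessLib

/-!
# Route `ByReductionTypeAtTwo` (rung K4), crux `AdditiveRankZeroAtTwo` (item
# stmt-BirchSwinnertonDyer-19098): the `K`-road in CANONICAL-model currency glues INTO the layer-1
# over-`K` child (modularity only) — seat `bsd-2adic-addL2`, GEN 4

HONEST FRAMING (cell `bsd-2adic`, run/shared/lean/pub/bsd-2adic/): theorems only; every research input
a hypothesis; nothing booked. With (II-K)^C `AddTwoL2Cyc.CycDescentOverKCAtTwo` (X5/TwoAdicAdditiveL2CycC.lean)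
both halves of the `K`-road live on the canonical model `W.baseChange K`, so «∀ admissible (W,K), ∃ (c,L,ϖ),
(I-K) ∧ (II-K)^C» implies the layer-1 child statement «∀ admissible (W,K), MissingPPartOverCAt (W.baseChange K) 2»
of the split proposal (HOME/addL2/split-ADD/) using MODULARITY ALONE — no globally minimal `K`-model, no
class-group condition, no sibling. PARTITION (D-0054): X5@2 ADDITIVE, quadratic sub-class (563) × p = 2 —
types-the-object-of; closes none.
-/

set_option autoImplicit false
set_option linter.dupNamespace false

noncomputable section

open scoped Classical

open WeierstrassCurve Literature.NumberTheory.EllipticCurves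
  Literature.NumberTheory.EllipticCurves.Rank1Residual
  Literature.NumberTheory.EllipticCurves.Rank1Residual.Typed
  Summit.BirchSwinnertonDyer.Rank1Residual.AdditivePotMult
  Summit.BirchSwinnertonDyer.Rank1Residual.X5.AddTwoL2
  Summit.BirchSwinnertonDyer.Rank1Residual.X5.AddTwoL2Cyc
  Summit.BirchSwinnertonDyer.BirchSwinnertonDyer.Theses.ByReductionTypeAtTwo

namespace Summit.BirchSwinnertonDyer.BirchSwinnertonDyer.Theorems

/-- **Layer 2 ⟹ layer 1 on the canonical model (modularity only).** If for every non-CM analytic-rank-0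
additive-at-`2` `W` and every quadratic `K` with semistable non-vanishing twist there are data `(c, L, ϖ)`
with (I-K) `CycMainConjectureOverKAtTwo (W.baseChange K) c L ϖ` and (II-K)^C `CycDescentOverKCAtTwo W K c L ϖ`,
then the over-`K` input `MissingPPartOverCAt (W.baseChange K) 2` holds on all admissible pairs
(`AddTwoL2Cyc.missingPPartOverCAt_of_cycRoadC`; `analyticRankEK W K = 0` from modularity).
[cite: GreenbergLNM1716, Thm. 4.1 (shape of (II-K))] [cite: Kato2004Asterisque, Conj. 12.10 (shape of (I-K))] -/
theorem addQuadraticOverKC_of_cycRoadC (hmod : hasEntireLFunction_rat)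
    (hRoad : ∀ (W : WeierstrassCurve ℚ) [W.IsElliptic] [W.IsGloballyMinimal],
      ¬ W.HasCM → W.analyticRank = 0 → Addv W 2 →
      ∀ (K : Type) [Field K] [NumberField K], Module.finrank ℚ K = 2 → SemistableTwistAtTwo W K →
        (W.quadraticTwist (NumberField.discr K : ℚ)).entireLFunction 1 ≠ 0 →
        ∃ (c : ℤ_[2]) (L : PowerSeries ℚ_[2]) (ϖ : ℚ),
          CycMainConjectureOverKAtTwo (W.baseChange K) c L ϖ ∧ CycDescentOverKCAtTwo W K c L ϖ) :
    ∀ (W : WeierstrassCurve ℚ) [W.IsElliptic] [W.IsGloballyMinimal],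
      ¬ W.HasCM → W.analyticRank = 0 → Addv W 2 →
      ∀ (K : Type) [Field K] [NumberField K], Module.finrank ℚ K = 2 → SemistableTwistAtTwo W K →
        (W.quadraticTwist (NumberField.discr K : ℚ)).entireLFunction 1 ≠ 0 →
        MissingPPartOverCAt (W.baseChange K) 2 := by
  intro W _ _ hcm hr hadd K _ _ h2 hst hL
  obtain ⟨c, L, ϖ, hIMC, hdesc⟩ := hRoad W hcm hr hadd K h2 hst hL
  exact missingPPartOverCAt_of_cycRoadC W K hmod hr hL hIMC hdesc

/-- **Crux `AdditiveRankZeroAtTwo` from the canonical `K`-road**: PRINT {GZK, modularity, Milne any-model,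
Hoffstein–Luo} + the three SIBLING rank-0 cruxes + the canonical road ∀-closed + the defect-`≥ 3` residue
⟹ the crux (previous theorem into `additiveRankZeroAtTwo_of_siblings_of_overKC_of_defect_of_hoffsteinLuo`).
[cite: Milne1972ArithmeticAV, §1 Thm. 1 (through DokchitserDokchitserAnnals2010 §2.1)]
[cite: HoffsteinLuo1997, Theorem (§1, pp. 435–436)] -/
theorem additiveRankZeroAtTwo_of_siblings_of_cycRoadC_of_defect
    (hGZK : rank_eq_analyticRank_of_analyticRank_le_one) (hmod : hasEntireLFunction_rat)
    (hMilneC : Milne1972.bsdQuotient_baseChange_quadratic_anyModel)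
    (hHL : HoffsteinLuo1997_exists_twist_L_one_ne_zero)
    (hOrd : GoodOrdinaryRankZeroAtTwo) (hMult : MultiplicativeRankZeroAtTwo)
    (hSS : SupersingularRankZeroAtTwo)
    (hRoad : ∀ (W : WeierstrassCurve ℚ) [W.IsElliptic] [W.IsGloballyMinimal],
      ¬ W.HasCM → W.analyticRank = 0 → Addv W 2 →
      ∀ (K : Type) [Field K] [NumberField K], Module.finrank ℚ K = 2 → SemistableTwistAtTwo W K →
        (W.quadraticTwist (NumberField.discr K : ℚ)).entireLFunction 1 ≠ 0 →
        ∃ (c : ℤ_[2]) (L : PowerSeries ℚ_[2]) (ϖ : ℚ),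
          CycMainConjectureOverKAtTwo (W.baseChange K) c L ϖ ∧ CycDescentOverKCAtTwo W K c L ϖ)
    (hD : ∀ (W : WeierstrassCurve ℚ) [W.IsElliptic] [W.IsGloballyMinimal],
      ¬ W.HasCM → W.analyticRank = 0 → DefectAtLeastThree W → MissingPPartAt W 2) :
    Summit.BirchSwinnertonDyer.BirchSwinnertonDyer.Theses.ByReductionTypeAtTwo.AdditiveRankZeroAtTwo :=
  additiveRankZeroAtTwo_of_siblings_of_overKC_of_defect_of_hoffsteinLuo hGZK hmod hMilneC hHL hOrd hMult hSS
    (addQuadraticOverKC_of_cycRoadC hmod hRoad) hD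

end Summit.BirchSwinnertonDyer.BirchSwinnertonDyer.Theorems

end
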